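import Summits.QuantumFields.YangMills.Theorems.PoincareLipschitzSobolevSamplingConsistency
import Summits.QuantumFields.YangMills.Theorems.PoincareLipschitzSobolevCellTranslationSumClosed
import Summits.QuantumFields.YangMills.Theorems.PoincareLipschitzSobolevBadBondEnergy
import Summits.QuantumFields.YangMills.Theorems.PoincareLipschitzSobolevSamplingL2Row
import HarnessLib

/-!
# `PoincareLipschitzSobolevSamplingConsistencyClosed` — LINE 25 S2♭″ brick (Γ5), CLOSED: «SOBOLEV SAMPLING CONSISTENCY» with NO hypotheses
# (crux `BlockLipschitzL` stmt-QuantumFields-23533 ∕ `HistoryTailL` stmt-QuantumFields-19936, LINE 25 `compactness_transfer`; helper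
# `--supports stmt-QuantumFields-23533 --as helper`, count-neutral)

Cell `ym3-torus` (YM ladder rung R3 = continuum SU(2) Yang–Mills on T³ — a RUNG, NOT the Clay problem: not d = 4, not infinite volume, not a
mass gap); width seat `ym3-torus-px5` (g8), pen of record for (Γ5-KNIT).  THEOREMS ONLY (0 `def`, 0 `sorry`, default heartbeats).

WHAT IS PROVED.  ★★★ `exists_unit_sample_of_sobolev_closed` — the Γ-KNIT's hypothesis `hΓ5` (px3 g8 ✓`PoincareLipschitzLatticeToContinuumLimit.
latticeToContinuumLimit_of (hΓ5)`), VERBATIM and UNCONDITIONAL: for a unit Sobolev map `V : Q → S³ ⊂ ℝ⁴` on the open cube with square-integrable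
weak gradient, scales `0 < s < s′ < 1` and `η > 0`, for all large `R` there is a UNIT lattice map `v : ℤ³ → S³` with
`R⁻¹·E_latt(v; Q_{⌊sR⌋}(0)) ≤ ∫_{Q_{s′}} dens(GV) + η` and `∫_{Q_s} ‖v(⌊Rx⌋) − V x‖² ≤ η`.
PROOF = ONE TERM: the door ✓p722329 `exists_unit_sample_of_sobolev (hB) (hC) (hD)` at the three landed rows — (Γ5-B) px15 g6
✓`PoincareLipschitzSobolevCellTranslationSumClosed.hB_holds`, (Γ5-C) w7 g13 ✓`PoincareLipschitzSobolevBadBondEnergy.bad_part_small` (through px15's adapter ✓`memLp_two_apply_of_integrableOn_dens`: `IntegrableOn dens` ⇒ `∀ v, MemLp (GV·v) 2`; the idle `κ < 1` absorbed), (Γ5-D) w4 g15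
✓`PoincareLipschitzSobolevSamplingL2Row.l2_row_of_sobolev` — hB and hD being the door's displayed binders character for character, hC's consequent likewise.
HONEST SCOPE.  (Γ5) only.  With it px3 g8's Γ-KNIT gives S2♭″ `stub_latticeToContinuumLimit` (its STUB alias files separately); S1″, `hImproveCoreFlat`,
`BlockLipschitzL`, `HistoryTailL` are NOT proved here.  YM₃ on T³ is rung R3, not Clay; the YM mass gap is NOT proved; no summit statement is proved here.

References: S. Luckhaus, Indiana Univ. Math. J. 37 (1988) 349–367; R. Hardt, D. Kinderlehrer, F.-H. Lin, Comm. Math. Phys. 105 (1986) 547–570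
[HardtKinderlehrerLin1986]; R. Alicandro, M. Cicalese, Arch. Ration. Mech. Anal. 192 (2009) 501–536 [AlicandroCicalese2008].
-/

set_option autoImplicit false

noncomputable section

open MeasureTheory
open scoped BigOperators

namespace Summit.QuantumFields.YangMills.Theorems.PoincareLipschitzSobolevSamplingConsistencyClosed

open Literature.MathematicalPhysics.QuantumFieldTheory.Balaban1983to89
open B4Eq19LatticeOperators (Zd box unitVec)
open Literature.Analysis.FunctionSpaces (HasWeakFDerivOn)
open Summit.QuantumFields.YangMills.Theorems.PoincareLipschitzSobolevSamplingConsistency (exists_unit_sample_of_sobolev)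
open Summit.QuantumFields.YangMills.Theorems.PoincareLipschitzSobolevCellTranslationSumClosed (hB_holds memLp_two_apply_of_integrableOn_dens)
open Summit.QuantumFields.YangMills.Theorems.PoincareLipschitzSobolevBadBondEnergy (bad_part_small)
open Summit.QuantumFields.YangMills.Theorems.PoincareLipschitzSobolevSamplingL2Row (l2_row_of_sobolev)

/-- ★★★ **(Γ5) SOBOLEV SAMPLING CONSISTENCY, CLOSED** — the Γ-KNIT's `hΓ5` with no hypotheses: unit Sobolev maps on the cube are sampled by
unit lattice maps with energy consistency from above on `Q_{⌊sR⌋}` against `∫_{Q_{s′}} dens + η` and `L²(Q_s)`-closeness `≤ η`, for all large `R`.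
One term: the door at the three landed rows. [folklore] [cite: Luckhaus1988, Lemma 1; HardtKinderlehrerLin1986, §2; AlicandroCicalese2008, §2] -/
theorem exists_unit_sample_of_sobolev_closed :
    ∀ (hQ : IsOpen {x : EuclideanSpace ℝ (Fin 3) | ∀ i : Fin 3, |x i| < 1})
      (V : EuclideanSpace ℝ (Fin 3) → EuclideanSpace ℝ (Fin 4)) (GV : EuclideanSpace ℝ (Fin 3) → (EuclideanSpace ℝ (Fin 3) →L[ℝ] EuclideanSpace ℝ (Fin 4))),
      HasWeakFDerivOn ⟨{x : EuclideanSpace ℝ (Fin 3) | ∀ i : Fin 3, |x i| < 1}, hQ⟩ volume V GV →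
      (∀ x : EuclideanSpace ℝ (Fin 3), (∀ i : Fin 3, |x i| < 1) → ‖V x‖ = 1) →
      IntegrableOn (fun x => ∑ i : Fin 3, ‖GV x (EuclideanSpace.single i (1:ℝ))‖ ^ 2) {x : EuclideanSpace ℝ (Fin 3) | ∀ i : Fin 3, |x i| < 1} volume →
      ∀ (s s' η : ℝ), 0 < s → s < s' → s' < 1 → 0 < η → ∃ R₀ : ℕ, ∀ R : ℕ, R₀ ≤ R →
        ∃ v : Zd 3 → EuclideanSpace ℝ (Fin 4), (∀ y, ‖v y‖ = 1) ∧
          (R : ℝ)⁻¹ * ∑ y ∈ box (0 : Zd 3) ⌊s * R⌋, ∑ μ : Fin 3, ‖v (y + unitVec μ) - v y‖ ^ 2 ≤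
            (∫ x in {x : EuclideanSpace ℝ (Fin 3) | ∀ i : Fin 3, |x i| < s'}, ∑ i : Fin 3, ‖GV x (EuclideanSpace.single i (1:ℝ))‖ ^ 2) + η ∧
          ∫ x in {x : EuclideanSpace ℝ (Fin 3) | ∀ i : Fin 3, |x i| < s}, ‖v (fun i => ⌊(R : ℝ) * x i⌋) - V x‖ ^ 2 ≤ η :=
  exists_unit_sample_of_sobolev hB_holds
    (fun hQ V GV hW h1 hd _ _ _ hκ _ hs hs1 hε =>
      bad_part_small V GV hW h1 (memLp_two_apply_of_integrableOn_dens hQ hW hd) hκ hs hs1 hε)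
    l2_row_of_sobolev

end Summit.QuantumFields.YangMills.Theorems.PoincareLipschitzSobolevSamplingConsistencyClosed

end
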